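import Summits.BirchSwinnertonDyer.BirchSwinnertonDyer.Theorems.UniversalToricDescentResidualSelmerExact
import HarnessLib

/-!
# Route UniversalToricDescent — the residual count WITHOUT the local hypothesis (L)/(iv):
# `#ι⁻¹(Sel_𝔭^Σ(K_∞, E[p^∞])) = #Sel_𝔭^Σ(K_∞, E[p^∞])[p]` from `E(K_∞)[p] = 0` ALONE

Lead prover bsd-wall-utd-p1 g12 (`--supports stmt-BirchSwinnertonDyer-26042 --as helper`; first brick of the
(iv)-free λ-transport = the general case of stub `stub_lambdaTransport` of line `sigmacongruence`, memo
HOME/bsd-wall-utd-p1/SIGMA-CONGRUENCE-utdp1g12.md §3/§6).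

`UniversalToricDescentResidualSelmerExact.natCard_residualSelmer_eq_natCard_selmerAc_pTorsion` (g6) proves
`#R_𝔭^Σ(K_∞, E[p]) = #Sel_𝔭^Σ(K_∞, E[p^∞])[p]` under the LOCAL hypothesis (L) «`E[p^∞]^{H ⊓ D_𝔭}` has no
`p`-torsion» (= (iv) `E(ℚ₃)[3] = 0` on the crux's habitat; false on 206 classes). (L) is used for TWO things:
(a) to make the Kummer map `ι : H¹(H, E[p]) → H¹(H, E[p^∞])` injective — which only needs the GLOBAL
«`E[p^∞]^H` has no `p`-torsion» (`E(K_∞)[p] = 0`, a consequence of `ρ̄` onto, cf. `…TowerNoPTorsion`); and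
(b) to identify the pull-back `ι⁻¹(Sel_𝔭^Σ)` with the STRICT residual Selmer group `R_𝔭^Σ` (at the strict place the
local Kummer kernel `T_𝔭 = E(K_{∞,𝔭})[p^∞] ⊗ 𝔽_p` must vanish). This file separates the two:

* `natCard_comap_torsionToPrimaryH1Sub_selmerAc_eq` — **under the GLOBAL hypothesis only**, `ι` restricts to a
  bijection `ι⁻¹(Sel_𝔭^Σ(K_∞, E[p^∞])) ≃ Sel_𝔭^Σ(K_∞, E[p^∞])[p]`, so the two have the same `Nat.card`.

So without (L) the λ-count reads `#Sel[p] = #ι⁻¹(Sel)`, and `ι⁻¹(Sel)` is the residual Selmer group whose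
condition at `𝔭` is «`loc_𝔭 ∈ T_𝔭(E)`» instead of «`loc_𝔭 = 0`»; the remaining ((iv)-free, Greenberg–Vatsal-type)
comparison `#ι⁻¹(Sel(E)) = #R_strict · #T_𝔭(E)` with `#T_𝔭(E) = p^{dim E[p]^{H ⊓ D_𝔭}}` an `E[p]`-invariant needs
the residual global-to-local SURJECTIVITY at `𝔭` (tower-level Poitou–Tate; memo §3/§6) and is NOT proved here.
THEOREMS ONLY; no definition, no named fact, no `sorry`. BSD is not advanced by this file.
References: [GreenbergVatsal2000] §2 Prop. (2.8) (pp. 26–27); [GreenbergLNM1716] §5 p. 114; [LeiMullerXia2023]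
Lemma 3.7 (the (H0) hypothesis).
-/

set_option autoImplicit false
-- `…BirchSwinnertonDyer.BirchSwinnertonDyer.Theorems…` is the problem's mandated namespace (D-0017).
set_option linter.dupNamespace false

noncomputable section

open scoped Classical

namespace Summit.BirchSwinnertonDyer.BirchSwinnertonDyer.Theorems.UniversalToricDescentResidualSelmerExact

open NumberField IsDedekindDomain Field
open Literature.NumberTheory.EllipticCurves Literature.NumberTheory.EllipticCurves.GreenbergSelmer
  Literature.NumberTheory.EllipticCurves.GreenbergVatsal2000
  Literature.NumberTheory.EllipticCurves.FineSelmerCoefficientMap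
  Literature.NumberTheory.GaloisRepresentations WeierstrassCurve
  Summit.BirchSwinnertonDyer.Rank1Residual.X11b Summit.BirchSwinnertonDyer.Rank1Residual.X11b.AcSelmer
  Summit.BirchSwinnertonDyer.Rank1Residual.O5.HeegnerLogTransport

variable {K : Type} [Field K] [NumberField K] (W : WeierstrassCurve K) [W.IsElliptic] {p : ℕ} [Fact p.Prime]
  (κ : ZpExtension K p)

/-- **`#ι⁻¹(Sel_𝔭^Σ(K_∞, E[p^∞])) = #Sel_𝔭^Σ(K_∞, E[p^∞])[p]` from `E(K_∞)[p] = 0` alone (no local hypothesis at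
the strict place).** `ι` is injective on `H¹(K_∞, E[p])` (`torsionToPrimaryH1Sub_injective_of_fixed` for `H`), kills
`p` (`p_smul_torsionToPrimaryH1Sub_eq_zero`), and every `p`-torsion class of `H¹(K_∞, E[p^∞])` lifts
(`exists_torsionToPrimaryH1Sub_eq`); membership of the lift in `ι⁻¹(Sel)` is tautological. Any `𝔭`, any `Σ`.
[cite: GreenbergVatsal2000, §2 Prop. (2.8) (pp. 26–27)] [cite: GreenbergLNM1716, §5 p. 114] -/
theorem natCard_comap_torsionToPrimaryH1Sub_selmerAc_eq
    (hG : ∀ m : W.geomPrimaryTorsion p, (∀ σ ∈ κ.kerSubgroup, σ • m = m) → p • m = 0 → m = 0)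
    (𝔭 : HeightOneSpectrum (𝓞 K)) (S : Set (HeightOneSpectrum (𝓞 K))) :
    Nat.card ((selmerAc W p κ 𝔭 S).comap (W.torsionToPrimaryH1Sub p κ.kerSubgroup)) =
      Nat.card {s : selmerAc W p κ 𝔭 S // p • s = 0} := by
  have hinj := torsionToPrimaryH1Sub_injective_of_fixed W p κ.kerSubgroup hG
  have hmem : ∀ y ∈ (selmerAc W p κ 𝔭 S).comap (W.torsionToPrimaryH1Sub p κ.kerSubgroup),
      W.torsionToPrimaryH1Sub p κ.kerSubgroup y ∈ selmerAc W p κ 𝔭 S := fun y hy ↦ hy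
  have htor : ∀ y : (selmerAc W p κ 𝔭 S).comap (W.torsionToPrimaryH1Sub p κ.kerSubgroup),
      p • (⟨W.torsionToPrimaryH1Sub p κ.kerSubgroup y, hmem y y.2⟩ : selmerAc W p κ 𝔭 S) = 0 :=
    fun y ↦ Subtype.ext (by
      rw [AddSubgroupClass.coe_nsmul, ZeroMemClass.coe_zero]
      exact p_smul_torsionToPrimaryH1Sub_eq_zero W κ.kerSubgroup _)
  let f : (selmerAc W p κ 𝔭 S).comap (W.torsionToPrimaryH1Sub p κ.kerSubgroup) →
      {s : selmerAc W p κ 𝔭 S // p • s = 0} :=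
    fun y ↦ ⟨⟨W.torsionToPrimaryH1Sub p κ.kerSubgroup y, hmem y y.2⟩, htor y⟩
  refine Nat.card_congr (Equiv.ofBijective f ⟨fun y₁ y₂ h ↦ ?_, fun s ↦ ?_⟩)
  · have h' := congrArg (fun s : {s : selmerAc W p κ 𝔭 S // p • s = 0} ↦
      ((s.1 : selmerAc W p κ 𝔭 S) : W.subgroupH1 p κ.kerSubgroup)) h
    exact Subtype.ext (hinj h')
  · obtain ⟨s, hs⟩ := s
    have hs' : p • (s : W.subgroupH1 p κ.kerSubgroup) = 0 := by
      rw [← AddSubgroupClass.coe_nsmul, hs, ZeroMemClass.coe_zero]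
    obtain ⟨x, hx⟩ := W.exists_torsionToPrimaryH1Sub_eq p W.zsmul_geomPoints_surjective_holds hs'
    have hxR : x ∈ (selmerAc W p κ 𝔭 S).comap (W.torsionToPrimaryH1Sub p κ.kerSubgroup) := by
      rw [AddSubgroup.mem_comap, hx]
      exact s.2
    exact ⟨⟨x, hxR⟩, Subtype.ext (Subtype.ext hx)⟩

/-- **Two `p`-congruent curves: the λ-counts agree iff the pull-backs have the same size.** For `E₁[p] ≅ E₂[p]`-type
situations one compares `ι₁⁻¹(Sel(E₁))` and `ι₂⁻¹(Sel(E₂))` inside `H¹(K_∞, E₁[p]) ≅ H¹(K_∞, E₂[p])`; this is the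
bookkeeping half: `#Sel(E₁)[p] = #Sel(E₂)[p] ↔ #ι₁⁻¹(Sel(E₁)) = #ι₂⁻¹(Sel(E₂))`, under `E_i(K_∞)[p] = 0` only.
[cite: GreenbergVatsal2000, §2 Prop. (2.8)] -/
theorem natCard_selmerAc_pTorsion_eq_iff_natCard_comap_eq (W₁ W₂ : WeierstrassCurve K) [W₁.IsElliptic]
    [W₂.IsElliptic]
    (hG₁ : ∀ m : W₁.geomPrimaryTorsion p, (∀ σ ∈ κ.kerSubgroup, σ • m = m) → p • m = 0 → m = 0)
    (hG₂ : ∀ m : W₂.geomPrimaryTorsion p, (∀ σ ∈ κ.kerSubgroup, σ • m = m) → p • m = 0 → m = 0)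
    (𝔭 : HeightOneSpectrum (𝓞 K)) (S : Set (HeightOneSpectrum (𝓞 K))) :
    Nat.card {s : selmerAc W₁ p κ 𝔭 S // p • s = 0} = Nat.card {s : selmerAc W₂ p κ 𝔭 S // p • s = 0} ↔
      Nat.card ((selmerAc W₁ p κ 𝔭 S).comap (W₁.torsionToPrimaryH1Sub p κ.kerSubgroup)) =
        Nat.card ((selmerAc W₂ p κ 𝔭 S).comap (W₂.torsionToPrimaryH1Sub p κ.kerSubgroup)) := by
  rw [natCard_comap_torsionToPrimaryH1Sub_selmerAc_eq W₁ κ hG₁,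
    natCard_comap_torsionToPrimaryH1Sub_selmerAc_eq W₂ κ hG₂]

end Summit.BirchSwinnertonDyer.BirchSwinnertonDyer.Theorems.UniversalToricDescentResidualSelmerExact

end
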